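import Summits.HodgeConjecture.HodgeConjecture.Theorems.Ring2WeilCoverageCMFieldNormResidueSymbolsDyadicResidueFields
import Mathlib.NumberTheory.NumberField.Norm
import Mathlib.FieldTheory.Finite.Basic
import Mathlib.Algebra.CharP.CharAndCard
import HarnessLib

/-!
# Ring 2 — Weil-family coverage, CM-field rows: residue fields of PRIME norm, rational integers as squares at places of
  degree two, DEGREE-ONE places cut out by a norm, and the places `(p, π)` with `π² = p·w` — toolkit for the rational
  prime rule (WEIL-FAMILY-COVERAGE «## b03», cell (xxi′), part 13)

research route conditional on HC_CM; not a corollary; Q11.4-sentence-2 already refuted in dim ≥ 3.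

Elementary facts about the finite places `v` of a number field `K` (of degree `2` where marked), proved from Mathlib's
ideal norm `Ideal.absNorm` (`|𝓞_K/v| = N v`) and adic valuations, for the sequel `…RationalPrimesQuadratic`, which
reads the class `[ℓ] ∈ F^×/Nm_{E/F}(E^×)` of a rational prime on Deligne's quadratic carriers
[cite: Deligne1982HodgeCycles, §4 p. 30 and (1)] at a degree-one place over `ℓ`:

* §28 valuations: `r ∈ vⁿ ∖ vⁿ⁺¹ ⟹ ord_v r = n`; `N((n)) = n^{[K:ℚ]}`.
* §29 residue fields: if `N v = ℓ` (prime) then `𝓞_K/v ≅ 𝔽_ℓ` and **an integer `n` is a square mod `v` iff `n` is a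
  square mod `ℓ`**; if `N v = ℓ²` then **EVERY integer is a square mod `v`** (`𝔽_ℓ ⊂ 𝔽_{ℓ²}²`: Euler's criterion,
  `(ℓ² - 1)/2 = (ℓ - 1)(ℓ + 1)/2`).
* §30 **degree-one places from a norm** (`[K:ℚ] = 2`): if `x, x' ∈ 𝓞_K` satisfy `x·x' = ℓ·m` with `ℓ ∤ m`,
  `N(x) = ±ℓ·m'` with `ℓ ∤ m'` and `ℓ² ∤ N(x')`, then `𝔭 = (ℓ, x)` is a PRIME of norm `ℓ` (its norm divides
  `gcd(ℓ², ℓm') = ℓ`, and `𝔭 = (1)` would force `x' ∈ ℓ𝓞_K`); if moreover `x' ∉ 𝔭` then `ord_𝔭 ℓ = 1`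
  (`ord_𝔭 x = ord_𝔭 ℓ ≥ 2` would give `𝔭 ⊆ 𝔭²`).
* §31 **the place `(p, π)` with `π² = p·w`, `(p, w) = (1)`** (`[K:ℚ] = 2`; e.g. `(2, √6)`, `(2, √10)`, `(2, 1+√3)`,
  `(3, √15)`): `(p, π)² = (p)`, so `(p, π)` is THE unique place over `p`, of norm `p`, with `ord p = 2` — the ramified
  places of the real quadratic fields of the census, INCLUDING the non-principal ones (`ℚ(√10)`, `ℚ(√15)`).
[folklore]  No new definition, no named fact, no sorry; nothing about the Hodge conjecture is asserted.
-/

noncomputable section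

set_option linter.dupNamespace false

open Polynomial NumberField IsDedekindDomain

namespace Summit.HodgeConjecture.HodgeConjecture.Ring2.WeilCoverageCM

section Toolkit

variable {K : Type*} [Field K] [NumberField K]

/-! ### §28 Valuations and norms of rational integers -/

/-- **`r ∈ vⁿ ∖ vⁿ⁺¹ ⟹ ord_v r = n`** (`v(r) = exp(-n)`). [folklore] -/
theorem intValuation_eq_exp_neg_of_mem_of_notMem (v : HeightOneSpectrum (𝓞 K)) {r : 𝓞 K} (n : ℕ)
    (h1 : r ∈ v.asIdeal ^ n) (h2 : r ∉ v.asIdeal ^ (n + 1)) : v.intValuation r = WithZero.exp (-(n : ℤ)) := by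
  have hr : r ≠ 0 := by rintro rfl; exact h2 (Submodule.zero_mem _)
  have hle := (v.intValuation_le_pow_iff_mem r n).2 h1
  have hnle : ¬ v.intValuation r ≤ WithZero.exp (-((n + 1 : ℕ) : ℤ)) := fun h ↦ h2 ((v.intValuation_le_pow_iff_mem r _).1 h)
  rw [v.intValuation_if_neg hr] at hle hnle ⊢
  rw [WithZero.exp_le_exp] at hle hnle
  rw [WithZero.exp_inj]
  omega

/-- **`N((n)) = n^{[K:ℚ]}`** for a natural number `n`. [folklore] -/
theorem absNorm_span_natCast (n : ℕ) : Ideal.absNorm (Ideal.span {(n : 𝓞 K)}) = n ^ Module.finrank ℚ K := by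
  rw [Ideal.absNorm_span_singleton, show (n : 𝓞 K) = algebraMap ℤ (𝓞 K) n by simp, Algebra.norm_algebraMap,
    NumberField.RingOfIntegers.rank, Int.natAbs_pow, Int.natAbs_natCast]

/-- The norm of a finite place is not `1`. [folklore] -/
theorem absNorm_asIdeal_ne_one (v : HeightOneSpectrum (𝓞 K)) : Ideal.absNorm v.asIdeal ≠ 1 :=
  fun h1 ↦ v.isPrime.ne_top (Ideal.absNorm_eq_one_iff.1 h1)

/-- **At a place `v ∋ ℓ` of a QUADRATIC field, `N v ∈ {ℓ, ℓ²}`** (`N v ∣ N((ℓ)) = ℓ²`, `N v ≠ 1`). [folklore] -/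
theorem absNorm_eq_or_eq_sq_of_natCast_mem (hK : Module.finrank ℚ K = 2) (v : HeightOneSpectrum (𝓞 K)) {ℓ : ℕ}
    (hℓ : ℓ.Prime) (hℓv : (ℓ : 𝓞 K) ∈ v.asIdeal) :
    Ideal.absNorm v.asIdeal = ℓ ∨ Ideal.absNorm v.asIdeal = ℓ ^ 2 := by
  have hdvd := Ideal.absNorm_dvd_absNorm_of_le ((Ideal.span_singleton_le_iff_mem _).2 hℓv)
  rw [absNorm_span_natCast, hK, Nat.dvd_prime_pow hℓ] at hdvd
  obtain ⟨i, hi, heq⟩ := hdvd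
  interval_cases i
  · rw [pow_zero] at heq; exact absurd heq (absNorm_asIdeal_ne_one v)
  · left; rw [heq, pow_one]
  · right; exact heq

/-! ### §29 Residue fields of prime norm and of prime-square norm -/

/-- `|𝓞_K/v| = N v` as a `Fintype.card`. [folklore] -/
theorem card_quotient_eq_absNorm (v : HeightOneSpectrum (𝓞 K)) [Fintype (𝓞 K ⧸ v.asIdeal)] :
    Fintype.card (𝓞 K ⧸ v.asIdeal) = Ideal.absNorm v.asIdeal := by
  rw [← Nat.card_eq_fintype_card, Ideal.absNorm_apply, Submodule.cardQuot_apply]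

/-- **A place of PRIME norm `ℓ` has residue field `𝔽_ℓ`: an integer `n` is a square mod `v` iff `n` is a square
mod `ℓ`.** [folklore] -/
theorem isSquare_intCast_residue_iff_of_absNorm_eq (v : HeightOneSpectrum (𝓞 K)) {ℓ : ℕ} (hℓ : ℓ.Prime)
    (hN : Ideal.absNorm v.asIdeal = ℓ) (n : ℤ) :
    IsSquare (Ideal.Quotient.mk v.asIdeal (n : 𝓞 K)) ↔ IsSquare ((n : ℤ) : ZMod ℓ) := by
  classical
  haveI : Finite (𝓞 K ⧸ v.asIdeal) := v.asIdeal.finiteQuotientOfFreeOfNeBot v.ne_bot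
  letI : Fintype (𝓞 K ⧸ v.asIdeal) := Fintype.ofFinite _
  have hcard : Fintype.card (𝓞 K ⧸ v.asIdeal) = ℓ := by rw [card_quotient_eq_absNorm, hN]
  let e := ZMod.ringEquivOfPrime (𝓞 K ⧸ v.asIdeal) hℓ hcard
  have he : e (n : ZMod ℓ) = Ideal.Quotient.mk v.asIdeal (n : 𝓞 K) := by rw [map_intCast, map_intCast]
  rw [← he]
  -- squares are preserved and reflected by the ring isomorphism `e : 𝔽_ℓ ≃ 𝓞_K/v`
  constructor
  · rintro ⟨r, hr⟩
    exact ⟨e.symm r, e.injective (by rw [map_mul, e.apply_symm_apply, ← hr])⟩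
  · rintro ⟨r, hr⟩
    exact ⟨e r, by rw [hr, map_mul]⟩

/-- `(2m+1)² / 2 = 2m · (m+1)` in `ℕ` (`(ℓ² - 1)/2 = (ℓ - 1)·(ℓ + 1)/2` for odd `ℓ`). [folklore] -/
theorem sq_div_two_of_odd (m : ℕ) : (2 * m + 1) ^ 2 / 2 = (2 * m + 1 - 1) * (m + 1) := by
  have h : (2 * m + 1) ^ 2 = 2 * (2 * m * (m + 1)) + 1 := by ring
  rw [h, Nat.add_sub_cancel, Nat.mul_add_div (by norm_num), show (1 : ℕ) / 2 = 0 from rfl, add_zero]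

/-- **A place of norm `ℓ²` (residue field `𝔽_{ℓ²}`): EVERY rational integer is a square mod `v`** — the non-zero
elements of the prime field `𝔽_ℓ` have order dividing `ℓ - 1 ∣ (ℓ² - 1)/2` (Euler's criterion), and in characteristic
`2` everything is a square. [folklore] -/
theorem isSquare_intCast_residue_of_absNorm_eq_sq (v : HeightOneSpectrum (𝓞 K)) {ℓ : ℕ} (hℓ : ℓ.Prime)
    (hN : Ideal.absNorm v.asIdeal = ℓ ^ 2) (n : ℤ) : IsSquare (Ideal.Quotient.mk v.asIdeal (n : 𝓞 K)) := by
  classical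
  haveI := Fact.mk hℓ
  haveI : Finite (𝓞 K ⧸ v.asIdeal) := v.asIdeal.finiteQuotientOfFreeOfNeBot v.ne_bot
  letI : Fintype (𝓞 K ⧸ v.asIdeal) := Fintype.ofFinite _
  haveI : v.asIdeal.IsMaximal := v.isMaximal
  letI : Field (𝓞 K ⧸ v.asIdeal) := Ideal.Quotient.field v.asIdeal
  have hcard : Fintype.card (𝓞 K ⧸ v.asIdeal) = ℓ ^ 2 := by rw [card_quotient_eq_absNorm, hN]
  haveI hchar : CharP (𝓞 K ⧸ v.asIdeal) ℓ := charP_of_card_eq_prime_pow hcard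
  let ψ := ZMod.castHom (dvd_refl ℓ) (𝓞 K ⧸ v.asIdeal)
  have hψ : ψ (n : ZMod ℓ) = Ideal.Quotient.mk v.asIdeal (n : 𝓞 K) := by rw [map_intCast, map_intCast]
  rw [← hψ]
  by_cases hn : (n : ZMod ℓ) = 0
  · rw [hn, map_zero]; exact IsSquare.zero
  rcases hℓ.eq_two_or_odd' with h2 | hodd
  · subst h2
    exact FiniteField.isSquare_of_char_two (ringChar.eq (𝓞 K ⧸ v.asIdeal) 2) _
  · obtain ⟨m, hm⟩ := hodd
    have h2 : ringChar (𝓞 K ⧸ v.asIdeal) ≠ 2 := by rw [ringChar.eq (𝓞 K ⧸ v.asIdeal) ℓ]; omega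
    have hne : ψ (n : ZMod ℓ) ≠ 0 := fun h0 ↦ hn (ψ.injective (by rw [h0, map_zero]))
    have hdiv : ℓ ^ 2 / 2 = (ℓ - 1) * (m + 1) := by rw [hm, sq_div_two_of_odd]
    rw [FiniteField.isSquare_iff h2 hne, hcard, hdiv, pow_mul, ← map_pow, ZMod.pow_card_sub_one_eq_one hn, map_one,
      one_pow]

/-! ### §30 Degree-one places cut out by a norm (`[K:ℚ] = 2`) -/

/-- If `x' = ℓ·t` in `𝓞_K` then `ℓ^{[K:ℚ]} ∣ N(x')`. [folklore] -/
theorem pow_dvd_norm_of_eq_natCast_mul {ℓ : ℕ} {x' t : 𝓞 K} (h : x' = ℓ * t) :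
    ((ℓ : ℤ) ^ Module.finrank ℚ K) ∣ Algebra.norm ℤ x' := by
  refine ⟨Algebra.norm ℤ t, ?_⟩
  rw [h, map_mul, show (ℓ : 𝓞 K) = algebraMap ℤ (𝓞 K) ℓ by simp, Algebra.norm_algebraMap,
    NumberField.RingOfIntegers.rank]

/-- **`(ℓ, x) ≠ (1)`** when `x·x' = ℓ·m` and `ℓ^{[K:ℚ]} ∤ N(x')`: `1 = aℓ + bx` would give `x' = ℓ(ax' + bm)`.
[folklore] -/
theorem span_natCast_sup_span_ne_top {ℓ : ℕ} {x x' : 𝓞 K} {m : ℤ} (hxx' : x * x' = ℓ * m)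
    (hN' : ¬ ((ℓ : ℤ) ^ Module.finrank ℚ K) ∣ Algebra.norm ℤ x') :
    Ideal.span {(ℓ : 𝓞 K)} ⊔ Ideal.span {x} ≠ ⊤ := by
  intro htop
  have h1 : (1 : 𝓞 K) ∈ Ideal.span {(ℓ : 𝓞 K)} ⊔ Ideal.span {x} := by rw [htop]; exact Submodule.mem_top
  obtain ⟨y, hy, z, hz, hyz⟩ := Submodule.mem_sup.1 h1
  obtain ⟨a, rfl⟩ := Ideal.mem_span_singleton'.1 hy
  obtain ⟨b, rfl⟩ := Ideal.mem_span_singleton'.1 hz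
  apply hN'
  refine pow_dvd_norm_of_eq_natCast_mul (t := a * x' + b * m) ?_
  calc x' = x' * (a * ℓ + b * x) := by rw [hyz, mul_one]
    _ = ℓ * (a * x') + b * (x * x') := by ring
    _ = ℓ * (a * x' + b * m) := by rw [hxx']; ring

/-- **The norm of `(ℓ, x)` divides `ℓ`** when `[K:ℚ] = 2` and `|N(x)| = ℓ·m'` with `ℓ ∤ m'`
(`N(ℓ, x) ∣ gcd(N((ℓ)), N((x))) = gcd(ℓ², ℓm') = ℓ`). [folklore] -/
theorem absNorm_span_natCast_sup_span_dvd (hK : Module.finrank ℚ K = 2) {ℓ : ℕ} (hℓ : ℓ.Prime) {x : 𝓞 K}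
    {m' : ℕ} (hN : (Algebra.norm ℤ x).natAbs = ℓ * m') (hm' : ¬ ℓ ∣ m') :
    Ideal.absNorm (Ideal.span {(ℓ : 𝓞 K)} ⊔ Ideal.span {x}) ∣ ℓ := by
  have h1 := Ideal.absNorm_dvd_absNorm_of_le (le_sup_left : Ideal.span {(ℓ : 𝓞 K)} ≤ Ideal.span {(ℓ : 𝓞 K)} ⊔ Ideal.span {x})
  have h2 := Ideal.absNorm_dvd_absNorm_of_le (le_sup_right : Ideal.span {x} ≤ Ideal.span {(ℓ : 𝓞 K)} ⊔ Ideal.span {x})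
  rw [absNorm_span_natCast, hK, Nat.dvd_prime_pow hℓ] at h1
  rw [Ideal.absNorm_span_singleton, hN] at h2
  obtain ⟨i, hi, heq⟩ := h1
  rw [heq] at h2 ⊢
  interval_cases i
  · exact ⟨ℓ, by rw [pow_zero, one_mul]⟩
  · rw [pow_one]
  · exfalso
    rw [pow_two] at h2
    exact hm' ((Nat.mul_dvd_mul_iff_left hℓ.pos).1 h2)

/-- **DEGREE-ONE PLACE FROM A NORM** (`[K:ℚ] = 2`): under `x·x' = ℓ·m`, `ℓ² ∤ N(x')`, `|N(x)| = ℓ·m'`, `ℓ ∤ m'`,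
the ideal `𝔭 = (ℓ, x)` is a prime of norm `ℓ` — a place of `K` over `ℓ` with residue field `𝔽_ℓ` containing `x`.
[folklore] -/
theorem exists_place_absNorm_eq_of_norm (hK : Module.finrank ℚ K = 2) {ℓ : ℕ} (hℓ : ℓ.Prime) {x x' : 𝓞 K} {m : ℤ}
    (hxx' : x * x' = ℓ * m) (hN' : ¬ ((ℓ : ℤ) ^ 2) ∣ Algebra.norm ℤ x') {m' : ℕ}
    (hN : (Algebra.norm ℤ x).natAbs = ℓ * m') (hm' : ¬ ℓ ∣ m') :
    ∃ v : HeightOneSpectrum (𝓞 K), v.asIdeal = Ideal.span {(ℓ : 𝓞 K)} ⊔ Ideal.span {x} ∧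
      Ideal.absNorm v.asIdeal = ℓ ∧ (ℓ : 𝓞 K) ∈ v.asIdeal ∧ x ∈ v.asIdeal := by
  set J := Ideal.span {(ℓ : 𝓞 K)} ⊔ Ideal.span {x} with hJ
  have hJtop : J ≠ ⊤ := span_natCast_sup_span_ne_top hxx' (by rwa [hK])
  have hNJ : Ideal.absNorm J = ℓ := by
    have hd := absNorm_span_natCast_sup_span_dvd hK hℓ hN hm'
    rcases (Nat.dvd_prime hℓ).1 hd with h1 | h
    · exact absurd (Ideal.absNorm_eq_one_iff.1 h1) hJtop
    · exact h
  have hprime : J.IsPrime := Ideal.isPrime_of_irreducible_absNorm (by rw [hNJ]; exact hℓ)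
  have hℓJ : (ℓ : 𝓞 K) ∈ J := Ideal.mem_sup_left (Ideal.mem_span_singleton_self _)
  have hbot : J ≠ ⊥ := fun h ↦ by
    rw [h, Submodule.mem_bot, Nat.cast_eq_zero] at hℓJ
    exact hℓ.ne_zero hℓJ
  exact ⟨⟨J, hprime, hbot⟩, rfl, hNJ, hℓJ, Ideal.mem_sup_right (Ideal.mem_span_singleton_self _)⟩

/-- **`ord_𝔭 ℓ = 1` at the place `𝔭 = (ℓ, x)`** when `x·x' = ℓ·m` with `x', m ∉ 𝔭`: `ord_𝔭 x = ord_𝔭 ℓ`, and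
`ord ≥ 2` would put `𝔭 = (ℓ, x)` inside `𝔭²`. [folklore] -/
theorem intValuation_natCast_eq_exp_neg_one_of_place (v : HeightOneSpectrum (𝓞 K)) {ℓ : ℕ} {x x' : 𝓞 K} {m : ℤ}
    (hv : v.asIdeal = Ideal.span {(ℓ : 𝓞 K)} ⊔ Ideal.span {x}) (hxx' : x * x' = ℓ * m)
    (hx' : x' ∉ v.asIdeal) (hm : (m : 𝓞 K) ∉ v.asIdeal) :
    v.intValuation (ℓ : 𝓞 K) = WithZero.exp (-1 : ℤ) := by
  have hℓv : (ℓ : 𝓞 K) ∈ v.asIdeal := by rw [hv]; exact Ideal.mem_sup_left (Ideal.mem_span_singleton_self _)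
  have hxv : x ∈ v.asIdeal := by rw [hv]; exact Ideal.mem_sup_right (Ideal.mem_span_singleton_self _)
  have heq : v.intValuation x = v.intValuation (ℓ : 𝓞 K) := by
    have h := congrArg v.intValuation hxx'
    rwa [map_mul, map_mul, HeightOneSpectrum.intValuation_eq_one_iff.2 hx',
      HeightOneSpectrum.intValuation_eq_one_iff.2 hm, mul_one, mul_one] at h
  refine intValuation_eq_exp_neg_of_mem_of_notMem v 1 (by rwa [pow_one]) fun (hℓ2 : (ℓ : 𝓞 K) ∈ v.asIdeal ^ 2) ↦ ?_
  have hx2 : x ∈ v.asIdeal ^ 2 := by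
    rw [← HeightOneSpectrum.intValuation_le_pow_iff_mem, heq, HeightOneSpectrum.intValuation_le_pow_iff_mem]
    exact hℓ2
  have hle : v.asIdeal ≤ v.asIdeal ^ 2 := by
    have h' : Ideal.span {(ℓ : 𝓞 K)} ⊔ Ideal.span {x} ≤ v.asIdeal ^ 2 :=
      sup_le ((Ideal.span_singleton_le_iff_mem _).2 hℓ2) ((Ideal.span_singleton_le_iff_mem _).2 hx2)
    rwa [← hv] at h'
  exact absurd hle (not_le_of_gt (Ideal.pow_lt_self v.asIdeal v.ne_bot v.isPrime.ne_top 2 le_rfl))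

/-! ### §31 The place `(p, π)` with `π² = p·w`, `(p, w) = (1)` (`[K:ℚ] = 2`): unique over `p`, norm `p`, `ord p = 2` -/

/-- **`(p, π)² = (p)`** when `π² = p·w` and `a·p + b·w = 1` (`(p,π)² = (p², pπ, π²) = p·(p, π, w) = (p)`). [folklore] -/
theorem span_pair_sq_eq_span_of_sq_eq_mul {p : ℕ} {π w a b : 𝓞 K} (hπ : π ^ 2 = p * w) (hab : a * p + b * w = 1) :
    (Ideal.span {(p : 𝓞 K)} ⊔ Ideal.span {π}) ^ 2 = Ideal.span {(p : 𝓞 K)} := by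
  rw [← Ideal.span_insert, sq, Ideal.span_pair_mul_span_pair]
  apply le_antisymm
  · rw [Ideal.span_le]
    rintro r hr
    simp only [Set.mem_insert_iff, Set.mem_singleton_iff] at hr
    rw [SetLike.mem_coe, Ideal.mem_span_singleton']
    rcases hr with rfl | rfl | rfl | rfl
    · exact ⟨p, rfl⟩
    · exact ⟨π, mul_comm _ _⟩
    · exact ⟨π, rfl⟩
    · exact ⟨w, by rw [← sq, hπ, mul_comm]⟩
  · rw [Ideal.span_singleton_le_iff_mem]
    have h : (p : 𝓞 K) = a * ((p : 𝓞 K) * p) + b * (π * π) := by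
      rw [← sq π, hπ]
      calc (p : 𝓞 K) = p * (a * p + b * w) := by rw [hab, mul_one]
        _ = a * ((p : 𝓞 K) * p) + b * (p * w) := by ring
    have hmem : a * ((p : 𝓞 K) * p) + b * (π * π) ∈
        Ideal.span {(p : 𝓞 K) * p, (p : 𝓞 K) * π, π * p, π * π} :=
      Ideal.add_mem _ (Ideal.mul_mem_left _ a (Ideal.subset_span (by simp)))
        (Ideal.mul_mem_left _ b (Ideal.subset_span (by simp)))
    rwa [← h] at hmem

/-- **`N(p, π) = p`** (`[K:ℚ] = 2`: `N(p, π)² = N((p)) = p²`). [folklore] -/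
theorem absNorm_span_pair_of_sq_eq_mul (hK : Module.finrank ℚ K = 2) {p : ℕ} {π w a b : 𝓞 K} (hπ : π ^ 2 = p * w)
    (hab : a * p + b * w = 1) : Ideal.absNorm (Ideal.span {(p : 𝓞 K)} ⊔ Ideal.span {π}) = p := by
  have h := congrArg Ideal.absNorm (span_pair_sq_eq_span_of_sq_eq_mul hπ hab)
  rw [map_pow, absNorm_span_natCast, hK] at h
  exact Nat.pow_left_injective two_ne_zero h

/-- **Every place over `p` IS `(p, π)`** (`[K:ℚ] = 2`, `p` prime, `π² = p·w`, `(p, w) = (1)`): `(p, π)` is prime (norm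
`p`), contained in every `v ∋ p` (`π² ∈ v`), hence equal to it. [folklore] -/
theorem asIdeal_eq_span_pair_of_sq_eq_mul (hK : Module.finrank ℚ K = 2) {p : ℕ} (hp : p.Prime) {π w a b : 𝓞 K}
    (hπ : π ^ 2 = p * w) (hab : a * p + b * w = 1) (v : HeightOneSpectrum (𝓞 K)) (hpv : (p : 𝓞 K) ∈ v.asIdeal) :
    v.asIdeal = Ideal.span {(p : 𝓞 K)} ⊔ Ideal.span {π} := by
  set J := Ideal.span {(p : 𝓞 K)} ⊔ Ideal.span {π} with hJ
  have hNJ : Ideal.absNorm J = p := absNorm_span_pair_of_sq_eq_mul hK hπ hab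
  have hprime : J.IsPrime := Ideal.isPrime_of_irreducible_absNorm (by rw [hNJ]; exact hp)
  have hπv : π ∈ v.asIdeal :=
    v.isPrime.mem_of_pow_mem 2 (by rw [hπ]; exact v.asIdeal.mul_mem_right _ hpv)
  have hle : J ≤ v.asIdeal :=
    sup_le ((Ideal.span_singleton_le_iff_mem _).2 hpv) ((Ideal.span_singleton_le_iff_mem _).2 hπv)
  have hbot : J ≠ ⊥ := fun h ↦ by
    have hpJ : (p : 𝓞 K) ∈ J := Ideal.mem_sup_left (Ideal.mem_span_singleton_self _)
    rw [h, Submodule.mem_bot, Nat.cast_eq_zero] at hpJ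
    exact hp.ne_zero hpJ
  exact ((hprime.isMaximal hbot).eq_of_le v.isPrime.ne_top hle).symm

/-- **The place over `p` is UNIQUE** under `π² = p·w`, `(p, w) = (1)` (`[K:ℚ] = 2`). [folklore] -/
theorem place_unique_of_sq_eq_mul (hK : Module.finrank ℚ K = 2) {p : ℕ} (hp : p.Prime) {π w a b : 𝓞 K}
    (hπ : π ^ 2 = p * w) (hab : a * p + b * w = 1) (v v' : HeightOneSpectrum (𝓞 K))
    (hpv : (p : 𝓞 K) ∈ v.asIdeal) (hpv' : (p : 𝓞 K) ∈ v'.asIdeal) : v = v' :=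
  HeightOneSpectrum.ext (by rw [asIdeal_eq_span_pair_of_sq_eq_mul hK hp hπ hab v hpv,
    asIdeal_eq_span_pair_of_sq_eq_mul hK hp hπ hab v' hpv'])

/-- **Its residue field is `𝔽_p`**: `N v = p` at every place `v ∋ p`. [folklore] -/
theorem absNorm_eq_of_sq_eq_mul (hK : Module.finrank ℚ K = 2) {p : ℕ} (hp : p.Prime) {π w a b : 𝓞 K}
    (hπ : π ^ 2 = p * w) (hab : a * p + b * w = 1) (v : HeightOneSpectrum (𝓞 K)) (hpv : (p : 𝓞 K) ∈ v.asIdeal) :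
    Ideal.absNorm v.asIdeal = p := by
  rw [asIdeal_eq_span_pair_of_sq_eq_mul hK hp hπ hab v hpv]
  exact absNorm_span_pair_of_sq_eq_mul hK hπ hab

/-- **`ord_v p = 2`** there (`(p) = v²`): `v(p) = exp(-2)`. [folklore] -/
theorem intValuation_eq_exp_neg_two_of_sq_eq_mul (hK : Module.finrank ℚ K = 2) {p : ℕ} (hp : p.Prime)
    {π w a b : 𝓞 K} (hπ : π ^ 2 = p * w) (hab : a * p + b * w = 1) (v : HeightOneSpectrum (𝓞 K))
    (hpv : (p : 𝓞 K) ∈ v.asIdeal) : v.intValuation (p : 𝓞 K) = WithZero.exp (-2 : ℤ) := by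
  have hsq : v.asIdeal ^ 2 = Ideal.span {(p : 𝓞 K)} := by
    rw [asIdeal_eq_span_pair_of_sq_eq_mul hK hp hπ hab v hpv]
    exact span_pair_sq_eq_span_of_sq_eq_mul hπ hab
  refine intValuation_eq_exp_neg_of_mem_of_notMem v 2 (by rw [hsq]; exact Ideal.mem_span_singleton_self _) fun h3 ↦ ?_
  have hle : v.asIdeal ^ 2 ≤ v.asIdeal ^ 3 := by rw [hsq]; exact (Ideal.span_singleton_le_iff_mem _).2 h3
  exact absurd hle (not_le_of_gt (Ideal.pow_succ_lt_pow v.ne_bot 2))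

/-- … so **`ord_v p` is EVEN** there (`log v(p) = -2`), for `p` read in `K`. [folklore] -/
theorem log_valuation_eq_neg_two_of_sq_eq_mul (hK : Module.finrank ℚ K = 2) {p : ℕ} (hp : p.Prime)
    {π w a b : 𝓞 K} (hπ : π ^ 2 = p * w) (hab : a * p + b * w = 1) (v : HeightOneSpectrum (𝓞 K))
    (hpv : (p : 𝓞 K) ∈ v.asIdeal) : WithZero.log (v.valuation K (p : K)) = -2 := by
  rw [show (p : K) = algebraMap (𝓞 K) K (p : 𝓞 K) by rw [map_natCast], HeightOneSpectrum.valuation_of_algebraMap,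
    intValuation_eq_exp_neg_two_of_sq_eq_mul hK hp hπ hab v hpv, WithZero.log_exp]

end Toolkit

end Summit.HodgeConjecture.HodgeConjecture.Ring2.WeilCoverageCM

end
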